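import Summits.ResolutionOfSingularities.ResolutionOfSingularities.Theorems.HomologicalConductorNoZenoPointBlowupChartAlgebra
import HarnessLib

/-!
# Crux `NoZenoR` (stmt-ResolutionOfSingularities-19943), slot 5 `stub_L1wCoreF`, (B1) UP-5 — part 2/3:
# the two charts of a point blow-up and their overlap (algebra)

OURS (cell res-hironaka, crux chain W4.4, seat res-L0-w44-stub-1 g11; object UP-5a/b of the (B1) split core of
slot 5 `stub_L1wCoreF`, res-L0-w44-stub-2 L1W-PREP §3.3 / lead B1-CENSUS-g8). Nothing here is a statement of the
manuscript under review (Hironaka 2017); AI-written, weaker than expert review. Def-free, fact-free.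

The TWO-CHART DATUM of the blow-up of `𝔪 = (u, v) ⊆ A` along a regular pair, abstractly: `A`-algebras
`Γ₁ ≅ A[X]/(uX − v)` (`T ↦ X̄`), `Γ₂ ≅ A[X]/(vX − u)` (`T' ↦ X̄`) and the overlap `Γ₁₂ = Γ₁[1/T]` (a domain) with
injective restriction maps `r₁, r₂`, `r₁ T · r₂ T' = 1`; `εᵢ : Γᵢ/𝔪Γᵢ ≅ (A/𝔪)[X]`. Proved here:

* `exists_eq_aeval_of_chartEquiv`, `algebraMap_eq_mul_of_chartEquiv`, `map_span_pair_eq_span_singleton`,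
  `map_span_pair_pow_eq` — every element of `Γ₁` is `P(T)`; `v = uT`; `𝔪ⁿΓ₁ = (uⁿ)`;
* `r_mem_span_pow_iff` — `r₁ c ∈ (ûⁿ) ⟺ c ∈ (u₁ⁿ)` (`Γ₁₂` is `Γ₁[1/T]`);
* `r_aeval_reflect`, `sub_mem_span_pow_iff`, `sub_mem_span_iff_map` — the gluing condition on the overlap
  transported to `Γ₁` (`Q(T') Tᵈ = Q^refl_d(T)`) and read in `(A/𝔪)[X]`;
* `exists_sub_algebraMap_mem` — compatible pairs modulo `𝔪` come from `A` (`Γ(F, 𝒪_F) = κ`);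
* `r_lam_sub_eq_zero`, `exists_lam_sub_mem` — the compatible pairs in `𝔪Γ₁/𝔪²Γ₁ × 𝔪Γ₂/𝔪²Γ₂` are the
  `λ(α, β) = (u(α + βT), v(β + αT'))` (`Γ(F, 𝓘_F/𝓘_F²) = κ ⊕ κT`).

References: J. Lipman, Publ. Math. IHÉS 36 (1969), §15 p. 229 [`Lipman1969`]; The Stacks Project, Tag 0804
(gluing of the charts `Spec A[I/a]` along `D(b/a) = D(a/b)`) [`StacksProject`].
-/

noncomputable section

-- single-problem summit: the doubled namespace component `ResolutionOfSingularities` is forced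
set_option linter.dupNamespace false

namespace Summit.ResolutionOfSingularities.ResolutionOfSingularities.Theorems.NoZeno.ExcCount.PointBlowup

open Polynomial

/-! ## §3 The two-chart datum of a point blow-up, algebraically -/

section TwoCharts

variable {A : Type*} [CommRing A] {Γ₁ Γ₂ Γ₁₂ : Type*} [CommRing Γ₁] [CommRing Γ₂]
  [CommRing Γ₁₂] [Algebra A Γ₁] [Algebra A Γ₂] [Algebra A Γ₁₂]
  (r₁ : Γ₁ →ₐ[A] Γ₁₂) (r₂ : Γ₂ →ₐ[A] Γ₁₂) (u v : A) (T : Γ₁) (T' : Γ₂)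
  (e₁ : Γ₁ ≃+* (A[X] ⧸ Ideal.span {C u * X - C v}))
  (e₂ : Γ₂ ≃+* (A[X] ⧸ Ideal.span {C v * X - C u}))

/-- On the `u`-chart every element is a polynomial in `T = v/u` over `A`. [folklore] -/
theorem exists_eq_aeval_of_chartEquiv
    (he₁ : ∀ a, e₁ (algebraMap A Γ₁ a) = Ideal.Quotient.mk _ (C a))
    (hT : T = e₁.symm (Ideal.Quotient.mk _ X)) (a : Γ₁) : ∃ P : A[X], a = aeval T P := by
  obtain ⟨P, hP⟩ := Ideal.Quotient.mk_surjective (e₁ a)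
  refine ⟨P, ?_⟩
  have hcomp : (e₁.symm : _ →+* Γ₁).comp (Ideal.Quotient.mk (Ideal.span {C u * X - C v})) =
      (aeval T : A[X] →ₐ[A] Γ₁).toRingHom := by
    apply Polynomial.ringHom_ext
    · intro a
      rw [RingHom.comp_apply, AlgHom.toRingHom_eq_coe, AlgHom.coe_toRingHom, aeval_C,
        RingEquiv.coe_toRingHom, ← he₁, RingEquiv.symm_apply_apply]
    · rw [RingHom.comp_apply, AlgHom.toRingHom_eq_coe, AlgHom.coe_toRingHom, aeval_X,
        RingEquiv.coe_toRingHom, hT]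
  have := congr_arg (fun f : A[X] →+* Γ₁ => f P) hcomp
  simp only [RingHom.comp_apply, RingEquiv.coe_toRingHom, AlgHom.toRingHom_eq_coe,
    AlgHom.coe_toRingHom] at this
  rw [← this, hP, RingEquiv.symm_apply_apply]

/-- On the `u`-chart, `v = u · T`. [folklore] -/
theorem algebraMap_eq_mul_of_chartEquiv
    (he₁ : ∀ a, e₁ (algebraMap A Γ₁ a) = Ideal.Quotient.mk _ (C a))
    (hT : T = e₁.symm (Ideal.Quotient.mk _ X)) :
    algebraMap A Γ₁ v = algebraMap A Γ₁ u * T := by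
  apply e₁.injective
  rw [map_mul, he₁, he₁, hT, RingEquiv.apply_symm_apply, ← map_mul, Ideal.Quotient.eq]
  exact Ideal.mem_span_singleton.mpr ⟨-1, by ring⟩

/-- The extension of `𝔪 = (u, v)` to the `u`-chart is the principal ideal `(u)`. [folklore] -/
theorem map_span_pair_eq_span_singleton (hvu : algebraMap A Γ₁ v = algebraMap A Γ₁ u * T) :
    (Ideal.span {u, v}).map (algebraMap A Γ₁) = Ideal.span {algebraMap A Γ₁ u} := by
  rw [Ideal.map_span, Set.image_insert_eq, Set.image_singleton]
  apply le_antisymm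
  · rw [Ideal.span_le]
    rintro x (rfl | rfl)
    · exact Ideal.subset_span rfl
    · show algebraMap A Γ₁ v ∈ Ideal.span {algebraMap A Γ₁ u}
      rw [hvu]
      exact Ideal.mul_mem_right _ _ (Ideal.subset_span rfl)
  · exact Ideal.span_mono (Set.singleton_subset_iff.mpr (Set.mem_insert _ _))

/-- Powers: `𝔪ⁿ Γ₁ = (uⁿ)`. [folklore] -/
theorem map_span_pair_pow_eq (hvu : algebraMap A Γ₁ v = algebraMap A Γ₁ u * T) (n : ℕ) :
    (Ideal.span {u, v}).map (algebraMap A Γ₁) ^ n = Ideal.span {algebraMap A Γ₁ u ^ n} := by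
  rw [map_span_pair_eq_span_singleton u v T hvu, Ideal.span_singleton_pow]

/-- **`r₁` detects `(uⁿ)`-membership**: `Γ₁₂` being `Γ₁[1/T]`, `r₁ c ∈ (ûⁿ) ↔ c ∈ (u₁ⁿ)`.
[folklore] -/
theorem r_mem_span_pow_iff [IsDomain Γ₁₂]
    (ε₁ : (Γ₁ ⧸ (Ideal.span {u, v}).map (algebraMap A Γ₁)) ≃+* (A ⧸ Ideal.span {u, v})[X])
    (hε₁C : ∀ a, ε₁ (Ideal.Quotient.mk _ (algebraMap A Γ₁ a)) = C (Ideal.Quotient.mk _ a))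
    (hε₁X : ε₁ (Ideal.Quotient.mk _ T) = X)
    (hvu : algebraMap A Γ₁ v = algebraMap A Γ₁ u * T) (hu : algebraMap A Γ₁₂ u ≠ 0)
    (hr₁ : Function.Injective r₁) (hloc : ∀ z : Γ₁₂, ∃ (c : Γ₁) (e : ℕ), r₁ T ^ e * z = r₁ c)
    (hgen₁ : ∀ a : Γ₁, ∃ P : A[X], a = aeval T P) (n : ℕ) (c : Γ₁) :
    r₁ c ∈ Ideal.span {algebraMap A Γ₁₂ u ^ n} ↔ c ∈ Ideal.span {algebraMap A Γ₁ u ^ n} := by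
  haveI : IsDomain Γ₁ := hr₁.isDomain r₁.toRingHom
  have hu₁ : algebraMap A Γ₁ u ≠ 0 := fun h => hu (by rw [← r₁.commutes, h, map_zero])
  constructor
  · intro h
    obtain ⟨z, hz⟩ := Ideal.mem_span_singleton'.mp h
    obtain ⟨c', e, he⟩ := hloc z
    have key : T ^ e * c = c' * algebraMap A Γ₁ u ^ n := by
      apply hr₁
      rw [map_mul, map_pow, map_mul, map_pow, r₁.commutes, ← he, mul_assoc, hz]
    refine mem_span_pow_of_T_pow_mul_mem (Ideal.span {u, v}) u T ε₁ hε₁C hε₁X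
      (map_span_pair_eq_span_singleton u v T hvu) hu₁ hgen₁ n e c ?_
    rw [key]
    exact Ideal.mul_mem_left _ _ (Ideal.subset_span rfl)
  · intro h
    obtain ⟨d, rfl⟩ := Ideal.mem_span_singleton'.mp h
    rw [map_mul, map_pow, r₁.commutes]
    exact Ideal.mul_mem_left _ _ (Ideal.subset_span rfl)

/-- **The reflection identity**: `r₁(Q^refl_d(T)) = r₂(Q(T')) · Tᵈ` on `Γ₁₂` (`T T' = 1`).
[folklore] -/
theorem r_aeval_reflect (hTT' : r₁ T * r₂ T' = 1) (Q : A[X]) {d : ℕ} (hQ : Q.natDegree ≤ d) :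
    r₁ (aeval T (reflect d Q)) = r₂ (aeval T' Q) * r₁ T ^ d := by
  letI : Invertible (r₂ T') := ⟨r₁ T, hTT', by rw [mul_comm]; exact hTT'⟩
  have h := eval₂_reflect_mul_pow (algebraMap A Γ₁₂) (r₂ T') d Q hQ
  have h1 : r₁ (aeval T (reflect d Q)) = eval₂ (algebraMap A Γ₁₂) (⅟ (r₂ T')) (reflect d Q) := by
    rw [← aeval_algHom_apply, aeval_def]; rfl
  have h2 : r₂ (aeval T' Q) = eval₂ (algebraMap A Γ₁₂) (r₂ T') Q := by
    rw [← aeval_algHom_apply, aeval_def]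
  rw [h1, h2, ← h, mul_assoc, ← mul_pow, mul_comm (r₂ T') (r₁ T), hTT', one_pow, mul_one]

/-- **Compatibility criterion**: `r₁ a - Tᵐ r₂(Q(T')) ∈ (ûⁿ)` iff
`Tᵈ a - Tᵐ Q^refl_d(T) ∈ (u₁ⁿ)` (`deg Q ≤ d`). [folklore] -/
theorem sub_mem_span_pow_iff [IsDomain Γ₁₂]
    (ε₁ : (Γ₁ ⧸ (Ideal.span {u, v}).map (algebraMap A Γ₁)) ≃+* (A ⧸ Ideal.span {u, v})[X])
    (hε₁C : ∀ a, ε₁ (Ideal.Quotient.mk _ (algebraMap A Γ₁ a)) = C (Ideal.Quotient.mk _ a))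
    (hε₁X : ε₁ (Ideal.Quotient.mk _ T) = X)
    (hvu : algebraMap A Γ₁ v = algebraMap A Γ₁ u * T) (hu : algebraMap A Γ₁₂ u ≠ 0)
    (hr₁ : Function.Injective r₁) (hloc : ∀ z : Γ₁₂, ∃ (c : Γ₁) (e : ℕ), r₁ T ^ e * z = r₁ c)
    (hgen₁ : ∀ a : Γ₁, ∃ P : A[X], a = aeval T P) (hTT' : r₁ T * r₂ T' = 1)
    (a : Γ₁) (Q : A[X]) {d : ℕ} (hQ : Q.natDegree ≤ d) (m n : ℕ) :
    r₁ a - r₁ T ^ m * r₂ (aeval T' Q) ∈ Ideal.span {algebraMap A Γ₁₂ u ^ n} ↔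
      T ^ d * a - T ^ m * aeval T (reflect d Q) ∈ Ideal.span {algebraMap A Γ₁ u ^ n} := by
  rw [← r_mem_span_pow_iff r₁ u v T ε₁ hε₁C hε₁X hvu hu hr₁ hloc hgen₁ n, map_sub, map_mul,
    map_mul, map_pow, map_pow, r_aeval_reflect r₁ r₂ T T' hTT' Q hQ]
  have hunit : IsUnit (r₁ T ^ d) := (IsUnit.of_mul_eq_one (r₂ T') hTT').pow d
  have : r₁ T ^ d * r₁ a - r₁ T ^ m * (r₂ (aeval T' Q) * r₁ T ^ d) =
      r₁ T ^ d * (r₁ a - r₁ T ^ m * r₂ (aeval T' Q)) := by ring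
  rw [this, Ideal.unit_mul_mem_iff_mem _ hunit]

/-- **Reading modulo `𝔪`**: `Tᵈ P(T) - Tᵐ Q^refl_d(T) ∈ (u₁)` iff `Xᵈ P̄ = Xᵐ Q̄^refl_d` in
`(A/𝔪)[X]`. [folklore] -/
theorem sub_mem_span_iff_map
    (ε₁ : (Γ₁ ⧸ (Ideal.span {u, v}).map (algebraMap A Γ₁)) ≃+* (A ⧸ Ideal.span {u, v})[X])
    (hε₁C : ∀ a, ε₁ (Ideal.Quotient.mk _ (algebraMap A Γ₁ a)) = C (Ideal.Quotient.mk _ a))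
    (hε₁X : ε₁ (Ideal.Quotient.mk _ T) = X)
    (hvu : algebraMap A Γ₁ v = algebraMap A Γ₁ u * T) (P Q : A[X]) (d m : ℕ) :
    T ^ d * aeval T P - T ^ m * aeval T (reflect d Q) ∈ Ideal.span {algebraMap A Γ₁ u} ↔
      X ^ d * P.map (Ideal.Quotient.mk (Ideal.span {u, v})) =
        X ^ m * reflect d (Q.map (Ideal.Quotient.mk (Ideal.span {u, v}))) := by
  have : T ^ d * aeval T P - T ^ m * aeval T (reflect d Q) =
      aeval T (X ^ d * P - X ^ m * reflect d Q) := by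
    simp only [map_sub, map_mul, map_pow, aeval_X]
  rw [this, ← map_span_pair_eq_span_singleton u v T hvu,
    aeval_mem_map_iff _ T ε₁ hε₁C hε₁X, Polynomial.map_sub, Polynomial.map_mul,
    Polynomial.map_mul, Polynomial.map_pow, Polynomial.map_pow, map_X, reflect_map, sub_eq_zero]

/-- **Sections modulo `𝔪` glue only from `A`**: if `a ∈ Γ₁` and `b ∈ Γ₂` agree modulo `(û)` on
the overlap then both are congruent to one and the same `c ∈ A` (the equaliser of
`κ[T] ⇉ κ[T, T⁻¹] ⇇ κ[T⁻¹]` is `κ`). [folklore] -/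
theorem exists_sub_algebraMap_mem [IsDomain Γ₁₂]
    (ε₁ : (Γ₁ ⧸ (Ideal.span {u, v}).map (algebraMap A Γ₁)) ≃+* (A ⧸ Ideal.span {u, v})[X])
    (hε₁C : ∀ a, ε₁ (Ideal.Quotient.mk _ (algebraMap A Γ₁ a)) = C (Ideal.Quotient.mk _ a))
    (hε₁X : ε₁ (Ideal.Quotient.mk _ T) = X)
    (ε₂ : (Γ₂ ⧸ (Ideal.span {u, v}).map (algebraMap A Γ₂)) ≃+* (A ⧸ Ideal.span {u, v})[X])
    (hε₂C : ∀ a, ε₂ (Ideal.Quotient.mk _ (algebraMap A Γ₂ a)) = C (Ideal.Quotient.mk _ a))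
    (hε₂X : ε₂ (Ideal.Quotient.mk _ T') = X)
    (hvu : algebraMap A Γ₁ v = algebraMap A Γ₁ u * T)
    (huv : algebraMap A Γ₂ u = algebraMap A Γ₂ v * T') (hu : algebraMap A Γ₁₂ u ≠ 0)
    (hr₁ : Function.Injective r₁) (hloc : ∀ z : Γ₁₂, ∃ (c : Γ₁) (e : ℕ), r₁ T ^ e * z = r₁ c)
    (hgen₁ : ∀ a : Γ₁, ∃ P : A[X], a = aeval T P) (hgen₂ : ∀ b : Γ₂, ∃ Q : A[X], b = aeval T' Q)
    (hTT' : r₁ T * r₂ T' = 1) (a : Γ₁) (b : Γ₂)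
    (h : r₁ a - r₂ b ∈ Ideal.span {algebraMap A Γ₁₂ u}) :
    ∃ c : A, a - algebraMap A Γ₁ c ∈ Ideal.span {algebraMap A Γ₁ u} ∧
      b - algebraMap A Γ₂ c ∈ Ideal.span {algebraMap A Γ₂ v} := by
  have h𝔪₂ : (Ideal.span {u, v}).map (algebraMap A Γ₂) = Ideal.span {algebraMap A Γ₂ v} := by
    rw [Set.pair_comm]; exact map_span_pair_eq_span_singleton v u T' huv
  obtain ⟨P, rfl⟩ := hgen₁ a
  obtain ⟨Q, hQ⟩ := hgen₂ b
  set d := Q.natDegree with hd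
  have h' : r₁ (aeval T P) - r₁ T ^ 0 * r₂ (aeval T' Q) ∈ Ideal.span {algebraMap A Γ₁₂ u ^ 1} := by
    rwa [pow_zero, one_mul, pow_one, ← hQ]
  rw [sub_mem_span_pow_iff r₁ r₂ u v T T' ε₁ hε₁C hε₁X hvu hu hr₁ hloc hgen₁ hTT' _ Q le_rfl 0 1,
    pow_one, sub_mem_span_iff_map u v T ε₁ hε₁C hε₁X hvu, pow_zero, one_mul] at h'
  obtain ⟨hp, hq⟩ := eq_C_of_X_pow_mul_eq_reflect (natDegree_map_le.trans le_rfl) h'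
  refine ⟨P.coeff 0, ?_, ?_⟩
  · have : aeval T P - algebraMap A Γ₁ (P.coeff 0) = aeval T (P - C (P.coeff 0)) := by
      simp only [map_sub, aeval_C]
    rw [this, ← map_span_pair_eq_span_singleton u v T hvu, aeval_mem_map_iff _ T ε₁ hε₁C hε₁X,
      Polynomial.map_sub, map_C, ← coeff_map, sub_eq_zero]
    exact hp
  · have : b - algebraMap A Γ₂ (P.coeff 0) = aeval T' (Q - C (P.coeff 0)) := by
      simp only [map_sub, aeval_C, hQ]
    rw [this, ← h𝔪₂, aeval_mem_map_iff _ T' ε₂ hε₂C hε₂X, Polynomial.map_sub, map_C, ← coeff_map,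
      sub_eq_zero]
    exact hq

/-- The kernel elements `λ(α, β) = (u(α + βT), v(β + αT'))` glue: their difference on the
overlap vanishes. [folklore] -/
theorem r_lam_sub_eq_zero (hvu : algebraMap A Γ₁ v = algebraMap A Γ₁ u * T)
    (hTT' : r₁ T * r₂ T' = 1) (α β : A) :
    r₁ (algebraMap A Γ₁ u * (algebraMap A Γ₁ α + algebraMap A Γ₁ β * T)) -
      r₂ (algebraMap A Γ₂ v * (algebraMap A Γ₂ β + algebraMap A Γ₂ α * T')) = 0 := by
  have h1 : algebraMap A Γ₁₂ v = algebraMap A Γ₁₂ u * r₁ T := by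
    simpa only [map_mul, AlgHom.commutes] using congr_arg r₁ hvu
  simp only [map_mul, map_add, AlgHom.commutes, h1]
  linear_combination (-(algebraMap A Γ₁₂ u * algebraMap A Γ₁₂ α)) * hTT'

/-- **The kernel of `E₂ → E₁` comes from `A × A`**: a compatible pair `(a, b)` with `a ∈ (u₁)`,
`b ∈ (v₂)`, `r₁ a ≡ r₂ b (mod û²)` is `λ(α, β)` modulo `(u₁²) × (v₂²)` (the equaliser of
`X·κ[X] ⇉ ⇇` in degree one is `κ ⊕ κT`). [folklore] -/
theorem exists_lam_sub_mem [IsDomain Γ₁₂]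
    (ε₁ : (Γ₁ ⧸ (Ideal.span {u, v}).map (algebraMap A Γ₁)) ≃+* (A ⧸ Ideal.span {u, v})[X])
    (hε₁C : ∀ a, ε₁ (Ideal.Quotient.mk _ (algebraMap A Γ₁ a)) = C (Ideal.Quotient.mk _ a))
    (hε₁X : ε₁ (Ideal.Quotient.mk _ T) = X)
    (ε₂ : (Γ₂ ⧸ (Ideal.span {u, v}).map (algebraMap A Γ₂)) ≃+* (A ⧸ Ideal.span {u, v})[X])
    (hε₂C : ∀ a, ε₂ (Ideal.Quotient.mk _ (algebraMap A Γ₂ a)) = C (Ideal.Quotient.mk _ a))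
    (hε₂X : ε₂ (Ideal.Quotient.mk _ T') = X)
    (hvu : algebraMap A Γ₁ v = algebraMap A Γ₁ u * T)
    (huv : algebraMap A Γ₂ u = algebraMap A Γ₂ v * T') (hu : algebraMap A Γ₁₂ u ≠ 0)
    (hr₁ : Function.Injective r₁) (hloc : ∀ z : Γ₁₂, ∃ (c : Γ₁) (e : ℕ), r₁ T ^ e * z = r₁ c)
    (hgen₁ : ∀ a : Γ₁, ∃ P : A[X], a = aeval T P) (hgen₂ : ∀ b : Γ₂, ∃ Q : A[X], b = aeval T' Q)
    (hTT' : r₁ T * r₂ T' = 1) (a : Γ₁) (b : Γ₂)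
    (ha : a ∈ Ideal.span {algebraMap A Γ₁ u}) (hb : b ∈ Ideal.span {algebraMap A Γ₂ v})
    (h : r₁ a - r₂ b ∈ Ideal.span {algebraMap A Γ₁₂ u ^ 2}) :
    ∃ α β : A,
      a - algebraMap A Γ₁ u * (algebraMap A Γ₁ α + algebraMap A Γ₁ β * T) ∈
          Ideal.span {algebraMap A Γ₁ u ^ 2} ∧
        b - algebraMap A Γ₂ v * (algebraMap A Γ₂ β + algebraMap A Γ₂ α * T') ∈
          Ideal.span {algebraMap A Γ₂ v ^ 2} := by
  have h𝔪₂ : (Ideal.span {u, v}).map (algebraMap A Γ₂) = Ideal.span {algebraMap A Γ₂ v} := by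
    rw [Set.pair_comm]; exact map_span_pair_eq_span_singleton v u T' huv
  have h1 : algebraMap A Γ₁₂ v = algebraMap A Γ₁₂ u * r₁ T := by
    simpa only [map_mul, AlgHom.commutes] using congr_arg r₁ hvu
  obtain ⟨a₁, rfl⟩ := Ideal.mem_span_singleton'.mp ha
  obtain ⟨b₁, rfl⟩ := Ideal.mem_span_singleton'.mp hb
  obtain ⟨P, rfl⟩ := hgen₁ a₁
  obtain ⟨Q, hQ⟩ := hgen₂ b₁
  set d := max 1 Q.natDegree with hd
  -- cancel one `û`
  have h' : r₁ (aeval T P) - r₁ T ^ 1 * r₂ (aeval T' Q) ∈ Ideal.span {algebraMap A Γ₁₂ u ^ 1} := by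
    obtain ⟨z, hz⟩ := Ideal.mem_span_singleton'.mp h
    have hz' : (z * algebraMap A Γ₁₂ u - (r₁ (aeval T P) - r₁ T ^ 1 * r₂ (aeval T' Q))) *
        algebraMap A Γ₁₂ u = 0 := by
      rw [sub_mul, mul_assoc, ← pow_two, hz, map_mul, map_mul, AlgHom.commutes, AlgHom.commutes,
        h1, ← hQ]
      ring
    rcases mul_eq_zero.mp hz' with h0 | h0
    · rw [pow_one]
      exact Ideal.mem_span_singleton'.mpr ⟨z, sub_eq_zero.mp h0⟩
    · exact absurd h0 hu
  rw [sub_mem_span_pow_iff r₁ r₂ u v T T' ε₁ hε₁C hε₁X hvu hu hr₁ hloc hgen₁ hTT' _ Q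
      (le_max_right _ _) 1 1, pow_one, sub_mem_span_iff_map u v T ε₁ hε₁C hε₁X hvu, pow_one] at h'
  obtain ⟨hp, hq⟩ := eq_linear_of_X_pow_mul_eq_X_mul_reflect
    (natDegree_map_le.trans (le_max_right _ _)) (le_max_left _ _) h'
  rw [coeff_map, coeff_map] at hp hq
  refine ⟨Q.coeff 1, Q.coeff 0, ?_, ?_⟩
  · have : aeval T P * algebraMap A Γ₁ u -
        algebraMap A Γ₁ u * (algebraMap A Γ₁ (Q.coeff 1) + algebraMap A Γ₁ (Q.coeff 0) * T) =
        algebraMap A Γ₁ u * aeval T (P - (C (Q.coeff 1) + C (Q.coeff 0) * X)) := by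
      simp only [map_sub, map_add, map_mul, aeval_C, aeval_X]; ring
    rw [this, pow_two]
    have hmem : aeval T (P - (C (Q.coeff 1) + C (Q.coeff 0) * X)) ∈
        Ideal.span {algebraMap A Γ₁ u} := by
      rw [← map_span_pair_eq_span_singleton u v T hvu, aeval_mem_map_iff _ T ε₁ hε₁C hε₁X,
        Polynomial.map_sub, Polynomial.map_add, Polynomial.map_mul, map_C, map_C, map_X,
        sub_eq_zero]
      exact hp
    obtain ⟨d', hd'⟩ := Ideal.mem_span_singleton'.mp hmem
    rw [← hd']
    exact Ideal.mem_span_singleton'.mpr ⟨d', by ring⟩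
  · have : b₁ * algebraMap A Γ₂ v -
        algebraMap A Γ₂ v * (algebraMap A Γ₂ (Q.coeff 0) + algebraMap A Γ₂ (Q.coeff 1) * T') =
        algebraMap A Γ₂ v * aeval T' (Q - (C (Q.coeff 0) + C (Q.coeff 1) * X)) := by
      simp only [map_sub, map_add, map_mul, aeval_C, aeval_X, hQ]; ring
    rw [this, pow_two]
    have hmem : aeval T' (Q - (C (Q.coeff 0) + C (Q.coeff 1) * X)) ∈
        Ideal.span {algebraMap A Γ₂ v} := by
      rw [← h𝔪₂, aeval_mem_map_iff _ T' ε₂ hε₂C hε₂X, Polynomial.map_sub, Polynomial.map_add,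
        Polynomial.map_mul, map_C, map_C, map_X, sub_eq_zero]
      exact hq
    obtain ⟨d', hd'⟩ := Ideal.mem_span_singleton'.mp hmem
    rw [← hd']
    exact Ideal.mem_span_singleton'.mpr ⟨d', by ring⟩

end TwoCharts

end Summit.ResolutionOfSingularities.ResolutionOfSingularities.Theorems.NoZeno.ExcCount.PointBlowup

end
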